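import Summits.BirchSwinnertonDyer.Rank1Residual.X10.ResidualSelmerLocalRamificationDiv
import Summits.BirchSwinnertonDyer.Rank1Residual.X10.ResidualSelmerLocalRamificationInt
import HarnessLib

/-!
# The `E[p]` instance of the N2 parity law, PART XI′: the `I_n` (`p ∣ n`) local ramification test
# READ ON THE INTEGER MODEL over `ℚ` (cell `b2b-bsdres`, unit `b2b-bsdres-x10` = N2 class lead,
# GEN 32; TOOL — one theorem, no definition, no named fact, nothing booked)

HONEST FRAMING (run/shared/lean/b2b/bsd-rank1-residual/, verbatim in every file): the goal of the
cell is to DELETE the COMBINATION-SHAPED residual classes of the Birch–Swinnerton-Dyer formula for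
ALL analytic-rank `≤ 1` elliptic curves over `ℚ` — "full BSD formula for every rank `≤ 1` curve in
class `C`" assembled STRICTLY from published theorems — so that the rank-`≤ 1` remainder becomes
exactly the CONSTRUCTION-SHAPED classes, which are TYPED (missing-input `Prop`s), NOT attempted.
This is not "finishing BSD". Class X10b (= N2) keeps its label CONSTRUCTION-SHAPED (NEEDS `X_A3`,
referee R82.3 / RESIDUAL-MAP §I N2); this file is a TOOL; no mark / label / tier / count moves.

## What

PART XI (`X10/ResidualSelmerLocalRamificationInt.lean`) with `ord_v Δ = p` relaxed to `p ∣ n = ord_v Δ`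
(PART X′, `X10/ResidualSelmerLocalRamificationDiv.lean`): for `W / ℚ` globally minimal with an integer
equation `E₀` (`E₀ ⊗ ℤ_v ⊗ ℚ_v = W ⊗ ℚ_v`), at a split multiplicative `v ∤ p` with `p ∣ ord_v Δ =: n`,
**`localKummerMap_mem_unramifiedSubgroup_iff_hasNonsingularReduction_nsmul_int`**:
`κ_v(P) ∈ H¹_ur ↔ (E₀ ⊗ ℤ_v).HasNonsingularReduction ((n/p) • P)`. With PART XII's decidable reading
(`not_hasNonsingularReduction_of_reduces_to_node` applied to the RATIONAL point `(n/p) • P`) this is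
the (G) certificate at split `I₆` / `I₁₅` places (TRIVIAL-ROADS §9: partner `22090l1`, `I₆` at `2` —
cells 22090n1, 154630n1, 242990d1, 242990f1, 340186p1, 472726e1; `354482d1`, `I₁₅` at `2`).

References: [SilvermanAEC2009] VII.1 Prop. 1.3(b), VII.2; [MazurRubin2007] proof of Thm. 1.4;
HOME/X10-AUDIT.md §38.9.
-/

set_option autoImplicit false

noncomputable section

open scoped Classical NNReal

open Function NumberField IsDedekindDomain Field WeierstrassCurve IsLocalRing
  Literature.NumberTheory.EllipticCurves Literature.NumberTheory.GaloisRepresentations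
  IsDedekindDomain.HeightOneSpectrum
open Summit.BirchSwinnertonDyer.Rank1Residual.Additive
open Summit.BirchSwinnertonDyer.Rank1Residual.X10.ResidualSelmerLocalRamification
open Summit.BirchSwinnertonDyer.Rank1Residual.X10.ResidualSelmerLocalRamificationDiv
open Summit.BirchSwinnertonDyer.Rank1Residual.X10.ResidualSelmerLocalRamificationInt

namespace Summit.BirchSwinnertonDyer.Rank1Residual.X10.ResidualSelmerLocalRamificationDivInt

/-- **`κ_v(P)` unramified iff `(n/p) • P ∈ E₀` READ ON THE INTEGER MODEL**, for `W / ℚ` globally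
minimal with an integer model `E₀` (`E₀ ⊗ ℤ_v ⊗ ℚ_v = W ⊗ ℚ_v`): at a split multiplicative `v ∤ p` with
`p ∣ ordMinimalDiscriminant v =: n`, `κ_v(P) ∈ H¹_ur ↔ (E₀ ⊗ ℤ_v).HasNonsingularReduction ((n/p) • P)`
(PART X′ + Silverman VII.1.3(b) as in PART XI). [cite: SilvermanAEC2009, VII.1 Prop. 1.3(b) and VII.2 Prop. 2.1]
[cite: MazurRubin2007, proof of Thm. 1.4] -/
theorem localKummerMap_mem_unramifiedSubgroup_iff_hasNonsingularReduction_nsmul_int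
    (W : WeierstrassCurve ℚ) [W.IsElliptic] [hGM : W.IsGloballyMinimal] {E₀ : WeierstrassCurve ℤ}
    (v : HeightOneSpectrum (𝓞 ℚ)) {p : ℕ} [hp : Fact p.Prime]
    (hpv : (p : 𝓞 ℚ) ∉ v.asIdeal) (hsplit : W.HasSplitMultiplicativeReductionAt v)
    (hn : p ∣ W.ordMinimalDiscriminant v) (hp0 : ((p : ℕ) : ℤ) ≠ 0)
    (hX : (E₀.map (Int.castRingHom (v.adicCompletionIntegers ℚ))).baseChange (v.adicCompletion ℚ) =
      W.baseChange (v.adicCompletion ℚ))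
    (P : (W.baseChange (v.adicCompletion ℚ)).toAffine.Point) :
    W.localKummerMap (v.adicCompletion ℚ) hp0 P ∈
        DiscreteGaloisModule.unramifiedSubgroup
          ((W.torsionGaloisModule (p : ℤ)).restrictField (v.adicCompletion ℚ)) 1 ↔
      (E₀.map (Int.castRingHom (v.adicCompletionIntegers ℚ))).HasNonsingularReduction
        (Affine.Point.congrEquiv hX.symm ((W.ordMinimalDiscriminant v / p) • P)) := by
  obtain ⟨C₀, hC₀⟩ := W.exists_variableChange_smul_eq_localMinimalModel v
  rw [localKummerMap_mem_unramifiedSubgroup_iff_hasNonsingularReduction_nsmul W v hpv hsplit hn hC₀ hp0 P]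
  generalize (W.ordMinimalDiscriminant v / p) • P = Q
  -- both `E ⊗ ℚ_v` and the local minimal model are `v`-minimal; `E ⊗ ℚ_v` has integral model `E₀ ⊗ ℤ_v`
  haveI hminX : (W.baseChange (v.adicCompletion ℚ)).IsMinimal (v.adicCompletionIntegers ℚ) :=
    hGM.isMinimal v
  have hIX : integralModel (v.adicCompletionIntegers ℚ) (W.baseChange (v.adicCompletion ℚ)) =
      E₀.map (Int.castRingHom (v.adicCompletionIntegers ℚ)) := integralModel_eq_of_baseChange_eq _ _ hX
  have hΔ : (W.baseChange (v.adicCompletion ℚ)).Δ ≠ 0 := by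
    rw [baseChange, map_Δ]
    exact (_root_.map_ne_zero _).mpr W.isUnit_Δ.ne_zero
  obtain ⟨D', hD'C, hD'I⟩ :=
    exists_variableChange_integralModel_eq (v.adicCompletionIntegers ℚ)
      (W₁ := W.baseChange (v.adicCompletion ℚ)) (W₂ := W.localMinimalModel v) (D := C₀) hC₀.symm hΔ
  have hJ : W.localMinimalIntegralModel v = D' • E₀.map (Int.castRingHom (v.adicCompletionIntegers ℚ)) := by
    rw [show W.localMinimalIntegralModel v =
      integralModel (v.adicCompletionIntegers ℚ) (W.localMinimalModel v) from rfl, hD'I, hIX]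
  rw [← LocalIndex.hasNonsingularReduction_pointEquiv_iff (E₀.map (Int.castRingHom (v.adicCompletionIntegers ℚ)))
      D' (Affine.Point.congrEquiv hX.symm Q), ← hasNonsingularReduction_congr hJ]
  -- the two points of `(D' • I)_{ℚ_v}` agree (`D'_{ℚ_v} = C₀`)
  refine Iff.of_eq (congrArg _ ?_)
  rcases Q with _ | ⟨x, y, h⟩
  · change Affine.Point.congrEquiv _ (Affine.Point.congrEquiv _
        (VariableChange.pointEquiv (W.baseChange (v.adicCompletion ℚ)) C₀ 0)) =
      Affine.Point.congrEquiv _ (VariableChange.pointEquiv _ _ (Affine.Point.congrEquiv hX.symm 0))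
    simp only [map_zero]
  · rw [VariableChange.pointEquiv_some, Affine.Point.congrEquiv_some, Affine.Point.congrEquiv_some,
      Affine.Point.congrEquiv_some, VariableChange.pointEquiv_some, Affine.Point.congrEquiv_some]
    exact point_some_congr (by rw [hD'C]) (by rw [hD'C])

end Summit.BirchSwinnertonDyer.Rank1Residual.X10.ResidualSelmerLocalRamificationDivInt

end
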